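import Summits.AtomisticToContinuum.FouriersLaw.Theorems.OddSectorIrreversibilityResponseDensityDensity
import Summits.AtomisticToContinuum.FouriersLaw.Theorems.OddSectorIrreversibilityResponseDensityKernelContinuity
import Summits.AtomisticToContinuum.FouriersLaw.Theorems.OddSectorIrreversibilityResponseDensityLeOne

/-!
# `ResponseDensity` from uniform mixing and detailed balance

Item stmt-AtomisticToContinuum-9144 (`ResponseDensity`, route `OddSectorIrreversibility`, sub-problem
`FouriersLaw` of `AtomisticToContinuum`): the CONDITIONAL reduction. For the pinned chain with
`ω₂, lam, β, γ > 0`, `N ≥ 1` and `T > 0`, the conclusion of `ResponseDensity` at `(T, N)` — an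
`L²(μ_{N,T,T})` response density testing `C_c^∞` observables and the bond currents — follows from the
weak-steady-state uniqueness hypothesis of the item together with two explicit analytic inputs at
`(T, N)` (binders, not named facts):

* `hUM`  — exponential convergence (2.5) of the transition semigroups with baths at `T ± δ/2` with
  constants uniform in `|δ| < δ₀` (uniform Harris bound near equilibrium);
* `hDUAL` — generalised detailed balance of the equilibrium kernels against the Gibbs weight.

Everything else is proved: the exact response identity (`…ResponseIdentity.lean`), the continuity
of the forecasts in the bath temperatures (`…KernelContinuity.lean`), the linear response
(`…LinearResponse.lean`), the density (`…Density.lean`), the identification of the steady family with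
the semigroup-invariant measures and of `μ_{N,T,T}` with the Gibbs measure (uniqueness hypothesis +
`pinnedChainSemigroup_ergodic`, `pinnedChain_isSteadyState_of_isInvariant`,
`pinnedChain_isSteadyState_gibbsMeasure`), and `N ≤ 1` (`…LeOne.lean`). No definitions.
-/

noncomputable section

open MeasureTheory ProbabilityTheory Filter Topology Set
open scoped NNReal ENNReal ContDiff

namespace Summit.AtomisticToContinuum.FouriersLaw.Theorems

open Literature.MathematicalPhysics.KineticTheory.HeatConduction
open Literature.Probability.Process Literature.MathematicalPhysics.KineticTheory OscillatorChain

variable {N : ℕ}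

section TestFunctions

variable {ω₂ lam β γ : ℝ} (hω : 0 < ω₂) (hl : 0 ≤ lam) (hβ : 0 ≤ β)
include hω hl hβ

/-- A smooth compactly supported observable is `C²` and dominated by a multiple of `e^{ϑH}` (`ϑ ≥ 0`). -/
theorem testFunction_bound (γ : ℝ) {ϑ : ℝ} (hϑ : 0 ≤ ϑ) {F : PhaseSpace N → ℝ}
    (hF : ContDiff ℝ ((⊤ : ℕ∞) : WithTop ℕ∞) F) (hFc : HasCompactSupport F) :
    ContDiff ℝ 2 F ∧ ∃ C : ℝ, ∀ y, |F y| ≤ C * Real.exp (ϑ * (pinnedChain ω₂ lam β γ).hamiltonian N y) := by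
  obtain ⟨C, hC⟩ := hF.continuous.bounded_above_of_compact_support hFc
  refine ⟨hF.of_le (by norm_cast), max C 0, fun y => ?_⟩
  have h1 : |F y| ≤ max C 0 := (Real.norm_eq_abs _ ▸ hC y).trans (le_max_left _ _)
  have h2 : 1 ≤ Real.exp (ϑ * (pinnedChain ω₂ lam β γ).hamiltonian N y) :=
    Real.one_le_exp (mul_nonneg hϑ (pinnedChain_hamiltonian_nonneg hω.le hl hβ γ N y))
  calc |F y| ≤ max C 0 * 1 := by rw [mul_one]; exact h1
    _ ≤ max C 0 * Real.exp (ϑ * (pinnedChain ω₂ lam β γ).hamiltonian N y) :=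
        mul_le_mul_of_nonneg_left h2 (le_max_right _ _)

omit hω hl hβ in
/-- The bond currents of the pinned chain are `C²` (polynomials in the coordinates). -/
theorem pinnedChain_contDiff_bondCurrent (γ : ℝ) (N : ℕ) (i : Fin N) :
    ContDiff ℝ 2 ((pinnedChain ω₂ lam β γ).bondCurrent N i) := by
  unfold OscillatorChain.bondCurrent
  simp only [pinnedChain_deriv_V]
  refine ContDiff.sum fun j _ => ?_
  split_ifs
  · fun_prop
  · exact contDiff_const

/-- The bond currents are dominated by a multiple of `e^{ϑH}` (`ϑ > 0`). -/
theorem pinnedChain_abs_bondCurrent_le_exp (γ : ℝ) (N : ℕ) {ϑ : ℝ} (hϑ : 0 < ϑ) (i : Fin N) :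
    ∃ C : ℝ, ∀ y, |(pinnedChain ω₂ lam β γ).bondCurrent N i y| ≤
      C * Real.exp (ϑ * (pinnedChain ω₂ lam β γ).hamiltonian N y) := by
  refine ⟨N * ((3 + β) / 2) * (2 * Real.exp ϑ / ϑ ^ 2), fun y => ?_⟩
  have hH0 := pinnedChain_hamiltonian_nonneg hω.le hl hβ γ N y
  have hj := pinnedChain_abs_bondCurrent_le hω.le hl hβ γ N i y
  have hsq := one_add_sq_le_exp hH0 hϑ
  calc |(pinnedChain ω₂ lam β γ).bondCurrent N i y|
      ≤ N * ((3 + β) / 2 * (1 + (pinnedChain ω₂ lam β γ).hamiltonian N y) ^ 2) := hj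
    _ = N * ((3 + β) / 2) * (1 + (pinnedChain ω₂ lam β γ).hamiltonian N y) ^ 2 := by ring
    _ ≤ N * ((3 + β) / 2) * (2 * Real.exp ϑ / ϑ ^ 2 *
          Real.exp (ϑ * (pinnedChain ω₂ lam β γ).hamiltonian N y)) :=
        mul_le_mul_of_nonneg_left hsq (by positivity)
    _ = _ := by ring

end TestFunctions

section Main

variable {ω₂ lam β γ : ℝ} (hω : 0 < ω₂) (hl : 0 ≤ lam) (hβ : 0 < β) (hγ : 0 < γ)
  (hN : 0 < N) {T : ℝ} (hT : 0 < T) {δ₀ : ℝ} (hδ₀ : 0 < δ₀) (hδ₀T : δ₀ < 2 * T)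
  {ϑ : ℝ} (hϑ : 0 < ϑ) (hϑT : ϑ < 1 / (T + δ₀ / 2)) (h2ϑ : 2 * ϑ < 1 / T)
include hω hl hβ hγ hN hT hδ₀ hδ₀T hϑ hϑT h2ϑ

omit hT hδ₀ hδ₀T hϑ hϑT h2ϑ in
/-- **Identification of the steady family.** Under uniqueness of the weak steady state, the member
`μ T_L T_R` (`T_L, T_R > 0`) of a steady family is the invariant probability measure of the transition
semigroup (the latter is a weak steady state: `pinnedChain_isSteadyState_of_isInvariant`). -/
theorem steadyFamily_isInvariant
    (huniq : ∀ (T_L T_R : ℝ), 0 < T_L → 0 < T_R → ∀ μ ν : Measure (PhaseSpace N),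
      (pinnedChain ω₂ lam β γ).IsSteadyState N T_L T_R μ →
      (pinnedChain ω₂ lam β γ).IsSteadyState N T_L T_R ν → μ = ν)
    (μ : ℝ → ℝ → Measure (PhaseSpace N))
    (hμ : ∀ T_L T_R : ℝ, 0 < T_L → 0 < T_R → (pinnedChain ω₂ lam β γ).IsSteadyState N T_L T_R (μ T_L T_R))
    {T_L T_R : ℝ} (hL : 0 < T_L) (hR : 0 < T_R) :
    IsProbabilityMeasure (μ T_L T_R) ∧
      ∀ t : ℝ≥0, (μ T_L T_R).bind ((pinnedChain ω₂ lam β γ).transitionKernel N T_L T_R t) = μ T_L T_R := by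
  obtain ⟨-, μs, hμs, hinvS, hrest⟩ := pinnedChainSemigroup_ergodic hω hl hβ hγ hN hL hR
  have hmax : 0 < 1 / max T_L T_R := by
    have : 0 < max T_L T_R := lt_max_of_lt_left hL
    positivity
  have hϑ0 : 0 < 1 / max T_L T_R / 2 := by positivity
  have hϑ1 : 1 / max T_L T_R / 2 < 1 / max T_L T_R := half_lt_self hmax
  have hss : (pinnedChain ω₂ lam β γ).IsSteadyState N T_L T_R μs :=
    pinnedChain_isSteadyState_of_isInvariant hω.le hl hβ.le γ N
      (pinnedChainSemigroup hω hl hβ.le hγ.le hN hL.le hR.le) hinvS hϑ0 (hrest _ hϑ0 hϑ1).1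
  have heq : μ T_L T_R = μs := huniq T_L T_R hL hR _ _ (hμ T_L T_R hL hR) hss
  rw [heq]
  exact ⟨hμs, fun t => hinvS t⟩

/-- **`ResponseDensity` at `(T, N)` from the two analytic inputs.** For the pinned chain
(`ω₂, β, γ > 0`, `lam ≥ 0`, `N ≥ 1`, `T > 0`), under uniqueness of the weak steady states at this `N`,
for every steady family `μ`: if (2.5) holds with constants uniform for baths at `T ± δ/2`, `|δ| < δ₀`
(`hUM`) and the equilibrium kernels satisfy detailed balance against the Gibbs weight (`hDUAL`) — with `0 < δ₀ < 2T`, `0 < ϑ < 1/(T + δ₀/2)`,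
`2ϑ < 1/T` — then there is `h ∈ L²(μ T T)` representing the `δ`-derivative at `0` of
`δ ↦ ∫ F dμ_{T+δ/2,T-δ/2}` for all `F ∈ C_c^∞` and for `F` each bond current. -/
theorem responseDensity_conclusion_of_hyps
    (huniq : ∀ (T_L T_R : ℝ), 0 < T_L → 0 < T_R → ∀ μ ν : Measure (PhaseSpace N),
      (pinnedChain ω₂ lam β γ).IsSteadyState N T_L T_R μ →
      (pinnedChain ω₂ lam β γ).IsSteadyState N T_L T_R ν → μ = ν)
    (μ : ℝ → ℝ → Measure (PhaseSpace N))
    (hμ : ∀ T_L T_R : ℝ, 0 < T_L → 0 < T_R → (pinnedChain ω₂ lam β γ).IsSteadyState N T_L T_R (μ T_L T_R))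
    {Cm c : ℝ} (hCm : 0 ≤ Cm) (hc : 0 < c)
    (hUM : ∀ δ : ℝ, |δ| < δ₀ → ∀ ν : Measure (PhaseSpace N), IsProbabilityMeasure ν →
      (∀ t : ℝ≥0, ν.bind ((pinnedChain ω₂ lam β γ).transitionKernel N (T + δ / 2) (T - δ / 2) t) = ν) →
      ∀ (z : PhaseSpace N) (t : ℝ≥0) (f : PhaseSpace N → ℝ), Continuous f →
        (∀ y, |f y| ≤ Real.exp (ϑ * (pinnedChain ω₂ lam β γ).hamiltonian N y)) →
        |(∫ y, f y ∂((pinnedChain ω₂ lam β γ).transitionKernel N (T + δ / 2) (T - δ / 2) t z)) -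
            ∫ y, f y ∂ν| ≤
          Cm * Real.exp (ϑ * (pinnedChain ω₂ lam β γ).hamiltonian N z) * Real.exp (-c * t))
    (hDUAL : ∀ (t : ℝ≥0) (F G : PhaseSpace N → ℝ) (CF CG : ℝ), ContDiff ℝ 2 F → ContDiff ℝ 2 G →
      (∀ y, |F y| ≤ CF * Real.exp (ϑ * (pinnedChain ω₂ lam β γ).hamiltonian N y)) →
      (∀ y, |G y| ≤ CG * Real.exp (ϑ * (pinnedChain ω₂ lam β γ).hamiltonian N y)) →
      ∫ x, Real.exp (-1 / T * (pinnedChain ω₂ lam β γ).hamiltonian N x) * G x *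
          (∫ y, F y ∂((pinnedChain ω₂ lam β γ).transitionKernel N T T t x)) =
        ∫ x, Real.exp (-1 / T * (pinnedChain ω₂ lam β γ).hamiltonian N x) * F (x.1, -x.2) *
          (∫ y, G (y.1, -y.2) ∂((pinnedChain ω₂ lam β γ).transitionKernel N T T t x))) :
    ∃ h : PhaseSpace N → ℝ, MemLp h 2 (μ T T) ∧
      (∀ F : PhaseSpace N → ℝ, ContDiff ℝ ((⊤ : ℕ∞) : WithTop ℕ∞) F → HasCompactSupport F →
        Tendsto (fun δ : ℝ => ((∫ x, F x ∂(μ (T + δ / 2) (T - δ / 2))) - ∫ x, F x ∂(μ T T)) / δ)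
          (𝓝[≠] 0) (𝓝 (∫ x, F x * h x ∂(μ T T)))) ∧
      (∀ i : Fin N, Tendsto (fun δ : ℝ =>
          ((∫ x, (pinnedChain ω₂ lam β γ).bondCurrent N i x ∂(μ (T + δ / 2) (T - δ / 2))) -
            ∫ x, (pinnedChain ω₂ lam β γ).bondCurrent N i x ∂(μ T T)) / δ)
          (𝓝[≠] 0) (𝓝 (∫ x, (pinnedChain ω₂ lam β γ).bondCurrent N i x * h x ∂(μ T T)))) := by
  -- identification of the family and of its equilibrium member
  have hident := fun (T_L T_R : ℝ) (hL : 0 < T_L) (hR : 0 < T_R) =>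
    steadyFamily_isInvariant hω hl hβ hγ hN huniq μ hμ hL hR
  haveI := pinnedChain_isProbabilityMeasure_gibbsMeasure hω hl hβ.le γ N hT
  have hTT : μ T T = (pinnedChain ω₂ lam β γ).gibbsMeasure N T :=
    huniq T T hT hT _ _ (hμ T T hT hT) (pinnedChain_isSteadyState_gibbsMeasure hω hl hβ.le γ N hT)
  -- the density
  obtain ⟨h, hL2, -, hrepr⟩ := pinnedChain_exists_responseDensity_of_dual hω hl hβ hγ hN hT hϑ h2ϑ hDUAL
  -- linear response for a weighted `C²` observable
  have key : ∀ (φ : PhaseSpace N → ℝ) (C : ℝ), ContDiff ℝ 2 φ →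
      (∀ y, |φ y| ≤ C * Real.exp (ϑ * (pinnedChain ω₂ lam β γ).hamiltonian N y)) →
      Tendsto (fun δ : ℝ => ((∫ x, φ x ∂(μ (T + δ / 2) (T - δ / 2))) - ∫ x, φ x ∂(μ T T)) / δ)
        (𝓝[≠] 0) (𝓝 (∫ x, φ x * h x ∂(μ T T))) := by
    intro φ C hφ2 hφ
    have hμP : ∀ δ : ℝ, |δ| < δ₀ → IsProbabilityMeasure (μ (T + δ / 2) (T - δ / 2)) := fun δ hδ =>
      (hident _ _ (bath_facts_of_abs_lt hδ₀T hϑT hδ).1 (bath_facts_of_abs_lt hδ₀T hϑT hδ).2.1).1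
    have hμI : ∀ δ : ℝ, |δ| < δ₀ → ∀ t : ℝ≥0, (μ (T + δ / 2) (T - δ / 2)).bind
        ((pinnedChain ω₂ lam β γ).transitionKernel N (T + δ / 2) (T - δ / 2) t) =
        μ (T + δ / 2) (T - δ / 2) := fun δ hδ =>
      (hident _ _ (bath_facts_of_abs_lt hδ₀T hϑT hδ).1 (bath_facts_of_abs_lt hδ₀T hϑT hδ).2.1).2
    have hlr := pinnedChain_linear_response_of_uniformMixing hω hl hβ hγ hN hT hδ₀ hδ₀T hϑ hϑT hφ2 hφ
      hCm hc hUM (pinnedChain_tendsto_integral_kernel_temps hω hl hβ.le hγ hN hT hϑ h2ϑ hφ2.continuous hφ)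
      (fun δ => μ (T + δ / 2) (T - δ / 2)) hμP hμI
    rw [hrepr φ C hφ2 hφ, ← hTT] at hlr
    simp only [zero_div, add_zero, sub_zero] at hlr
    exact hlr
  refine ⟨h, hTT ▸ hL2, fun F hF hFc => ?_, fun i => ?_⟩
  · obtain ⟨hF2, C, hC⟩ := testFunction_bound hω hl hβ.le γ hϑ.le hF hFc (N := N)
    exact key F C hF2 hC
  · obtain ⟨C, hC⟩ := pinnedChain_abs_bondCurrent_le_exp hω hl hβ.le γ N hϑ i
    exact key _ C (pinnedChain_contDiff_bondCurrent γ N i) hC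


end Main

/-- **`ResponseDensity` from the two analytic inputs at every `(T, N)`.** If for all admissible
parameters, every `T > 0` and every `N ≥ 1` there are `δ₀, ϑ, C_m, c` with `0 < δ₀ < 2T`,
`0 < ϑ < 1/(T + δ₀/2)`, `2ϑ < 1/T`, `C_m ≥ 0`, `c > 0` such that the uniform exponential convergence
`hUM` and the detailed balance `hDUAL` of
`responseDensity_conclusion_of_hyps` hold, then `ResponseDensity` holds (`N = 0` by
`responseDensity_conclusion_of_le_one`). -/
theorem responseDensity_of_hyps
    (H : ∀ ω₂ lam β γ : ℝ, 0 < ω₂ → 0 < lam → 0 < β → 0 < γ → ∀ T : ℝ, 0 < T → ∀ N : ℕ, 0 < N →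
      ∃ (δ₀ ϑ Cm c : ℝ), 0 < δ₀ ∧ δ₀ < 2 * T ∧ 0 < ϑ ∧ ϑ < 1 / (T + δ₀ / 2) ∧ 2 * ϑ < 1 / T ∧
        0 ≤ Cm ∧ 0 < c ∧
        (∀ δ : ℝ, |δ| < δ₀ → ∀ ν : Measure (PhaseSpace N), IsProbabilityMeasure ν →
          (∀ t : ℝ≥0, ν.bind ((pinnedChain ω₂ lam β γ).transitionKernel N (T + δ / 2) (T - δ / 2) t) = ν) →
          ∀ (z : PhaseSpace N) (t : ℝ≥0) (f : PhaseSpace N → ℝ), Continuous f →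
            (∀ y, |f y| ≤ Real.exp (ϑ * (pinnedChain ω₂ lam β γ).hamiltonian N y)) →
            |(∫ y, f y ∂((pinnedChain ω₂ lam β γ).transitionKernel N (T + δ / 2) (T - δ / 2) t z)) -
                ∫ y, f y ∂ν| ≤
              Cm * Real.exp (ϑ * (pinnedChain ω₂ lam β γ).hamiltonian N z) * Real.exp (-c * t)) ∧
        (∀ (t : ℝ≥0) (F G : PhaseSpace N → ℝ) (CF CG : ℝ), ContDiff ℝ 2 F → ContDiff ℝ 2 G →
          (∀ y, |F y| ≤ CF * Real.exp (ϑ * (pinnedChain ω₂ lam β γ).hamiltonian N y)) →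
          (∀ y, |G y| ≤ CG * Real.exp (ϑ * (pinnedChain ω₂ lam β γ).hamiltonian N y)) →
          ∫ x, Real.exp (-1 / T * (pinnedChain ω₂ lam β γ).hamiltonian N x) * G x *
              (∫ y, F y ∂((pinnedChain ω₂ lam β γ).transitionKernel N T T t x)) =
            ∫ x, Real.exp (-1 / T * (pinnedChain ω₂ lam β γ).hamiltonian N x) * F (x.1, -x.2) *
              (∫ y, G (y.1, -y.2) ∂((pinnedChain ω₂ lam β γ).transitionKernel N T T t x)))) :
    Summit.AtomisticToContinuum.FouriersLaw.Theses.OddSectorIrreversibility.ResponseDensity := by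
  intro ω₂ lam β γ hω hl hβ hγ huniq μ hμ T hT N
  rcases Nat.eq_zero_or_pos N with rfl | hN
  · exact responseDensity_conclusion_of_le_one (pinnedChain ω₂ lam β γ) zero_le_one hT
      (huniq 0 T T hT hT) (μ 0) (hμ 0)
  · obtain ⟨δ₀, ϑ, Cm, c, hδ₀, hδ₀T, hϑ, hϑT, h2ϑ, hCm, hc, hUM, hDUAL⟩ :=
      H ω₂ lam β γ hω hl hβ hγ T hT N hN
    exact responseDensity_conclusion_of_hyps hω hl.le hβ hγ hN hT hδ₀ hδ₀T hϑ hϑT h2ϑ (huniq N) (μ N)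
      (hμ N) hCm hc hUM hDUAL


end Summit.AtomisticToContinuum.FouriersLaw.Theorems

end
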